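import Summits.NavierStokesRegularity.NavierStokesRegularity.Theorems.EulerZoomLiouvillePowerGaugeEulerLiouvilleProfileEnergyEquality
import Literature.Analysis.FluidPDE.WholeSpaceIBP
import HarnessLib

/-!
# Energy-deflation Liouville for finite-energy self-similar Euler profiles
# (crux `EulerZoomLiouville.PowerGaugeEulerLiouville` = stmt-NavierStokesRegularity-19832, line `birth`, rung C1)

Route `EulerZoomLiouville` (NavierStokesRegularity).  First consequence of the profile LOCAL ENERGY EQUALITY
(`ProfileEnergy.profile_local_energy_equality`, `…ProfileEnergyEquality.lean`): a profile `(V, P)` satisfying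
`(2 − 5γ)∫σ|V|² = ∫(|V|²+2P)⟪V,∇σ⟫ + γ∫|V|²⟪y,∇σ⟫` for all test `σ`, with FINITE ENERGY and integrable
Bernoulli flux at infinity (`V ∈ L² ∩ L³(ℝ³)`, `P ∈ L^{3/2}(ℝ³)`) and a NON-energy-conserving exponent
`γ ≠ 2/5` (`α = 1/γ − 1 ≠ 3/2`), vanishes: `profile_ae_eq_zero_of_energyEquality`.  Test with the radial
cut-offs `cutoff R` (`R = n+1 → ∞`): the flux terms are `O(R⁻¹(‖V‖₃³ + ‖P‖_{3/2}‖V‖₃))` and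
`O(∫_{|y|≥R}|V|²)`, so `(2 − 5γ)‖V‖₂² = 0`.  For exactly self-similar members of the power-gauged class with
`0 < ρ < 1/2` (`γ = 1/(2+ρ) ∈ (2/5, 1/2)`, energy DEFLATION: `‖u(t)‖₂² = (−t)^{5γ−2}‖V‖₂² ↓ 0`) this is a
Liouville theorem the one-sided local energy inequality cannot give (deflation is consistent with the
inequality); it uses the Euler momentum identity through the energy equality (Chae–Shvydkoy 2013 §1: "`α = N/2`
is the only scaling consistent with the energy conservation for globally self-similar solutions" — stated there
for regular profiles).  Honest scope: the natural in-window candidates have INFINITE energy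
(`∫_{B_L}|V|² ~ L^{1−2ρ}`); this stratum removes the finite-energy, `L³`-profile ones.  WHAT THIS IS NOT: not NS
regularity, not the crux; `--supports` stmt-19832. [folklore; cf. ChaeShvydkoy2013 §1]
-/

noncomputable section

set_option linter.dupNamespace false

open MeasureTheory Set Filter Topology Metric Function TopologicalSpace
open scoped ENNReal NNReal RealInnerProductSpace

namespace Summit.NavierStokesRegularity.NavierStokesRegularity.Theorems.PowerGaugeEulerLiouville

open Literature.Analysis Literature.Analysis.FunctionSpaces Literature.Analysis.FluidPDE

namespace ProfileEnergy

/-- **Energy-deflation Liouville for self-similar Euler profiles with finite energy.**  If a profile `(V, P)`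
satisfies the LOCAL ENERGY EQUALITY of `profile_local_energy_equality` (conclusion taken as hypothesis `hEE`),
and moreover `V ∈ L² ∩ L³(ℝ³)`, `P ∈ L^{3/2}(ℝ³)` and the
exponent is not the energy-conserving one (`γ ≠ 2/5`, i.e. `α ≠ 3/2`), then `V = 0` a.e.: testing the
LOCAL ENERGY EQUALITY with the radial cut-offs `cutoff R` and letting `R → ∞`, the two flux terms are
`O(R⁻¹(‖V‖₃³ + ‖P‖_{3/2}‖V‖₃))` and `O(∫_{|y|≥R}|V|²)`, so `(2 − 5γ)‖V‖₂² = 0`.  (For exactly self-similar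
members `u = (−t)^{γ−1}V(x/(−t)^γ)` this is the statement that the total energy `(−t)^{5γ−2}‖V‖₂²` of a
finite-energy profile is conserved only at `γ = 2/5`; Chae–Shvydkoy 2013 §1: "`α = N/2` is the only scaling
consistent with the energy conservation for globally self-similar solutions"; here for `H¹_loc` profiles
through the kernel-checked energy equality, in the ONE direction the local energy inequality does not give.)
[folklore; cf. ChaeShvydkoy2013 §1] -/
theorem profile_ae_eq_zero_of_energyEquality {γ : ℝ} (hγ : γ ≠ 2 / 5)
    {V : EuclideanSpace ℝ (Fin 3) → EuclideanSpace ℝ (Fin 3)} {P : EuclideanSpace ℝ (Fin 3) → ℝ}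
    (hEE : ∀ σ : EuclideanSpace ℝ (Fin 3) → ℝ, IsTestFunctionOn (⊤ : Opens (EuclideanSpace ℝ (Fin 3))) σ →
      (2 - 5 * γ) * ∫ x, σ x * ‖V x‖ ^ 2 =
        (∫ x, (‖V x‖ ^ 2 + 2 * P x) * ⟪V x, gradient σ x⟫) + γ * ∫ x, ‖V x‖ ^ 2 * ⟪x, gradient σ x⟫)
    (hV2 : MemLp V 2 volume) (hV3 : MemLp V 3 volume) (hP32 : MemLp P (3 / 2 : ℝ≥0∞) volume) :
    V =ᵐ[volume] 0 := by
  -- ### integrability of the three global integrands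
  have hVm : AEStronglyMeasurable V volume := hV2.1
  have hV2i : Integrable (fun y => ‖V y‖ ^ 2) volume := hV2.integrable_norm_pow two_ne_zero
  have hV3i : Integrable (fun y => ‖V y‖ ^ 3) volume := hV3.integrable_norm_pow (by norm_num)
  haveI : ENNReal.HolderTriple (3 / 2 : ℝ≥0∞) 3 1 := by
    refine ⟨?_⟩
    rw [ENNReal.inv_div (Or.inr (by norm_num)) (Or.inr (by norm_num)), inv_one]
    have e3 : (3 : ℝ≥0∞)⁻¹ = ((3⁻¹ : ℝ≥0) : ℝ≥0∞) := by rw [ENNReal.coe_inv (by norm_num)]; norm_num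
    have e23 : (2 / 3 : ℝ≥0∞) = ((2 / 3 : ℝ≥0) : ℝ≥0∞) := by rw [ENNReal.coe_div (by norm_num)]; norm_num
    rw [e3, e23, ← ENNReal.coe_add, ← ENNReal.coe_one, ENNReal.coe_inj]
    norm_num
  have hPVi : Integrable (fun y => |P y| * ‖V y‖) volume := by
    have h := MemLp.mul (p := (3 / 2 : ℝ≥0∞)) (q := 3) (r := 1) hV3.norm hP32.abs
    rw [memLp_one_iff_integrable] at h
    simpa [Pi.mul_def, mul_comm] using h
  -- the flux integrand `F = |V|³ + 2|P||V|`
  have hFi : Integrable (fun y => ‖V y‖ ^ 3 + 2 * (|P y| * ‖V y‖)) volume := hV3i.add (hPVi.const_mul 2)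
  -- ### the cut-offs
  obtain ⟨C, hC0, hC⟩ := exists_norm_fderiv_cutoff_le (E := EuclideanSpace ℝ (Fin 3))
  set χ : ℕ → EuclideanSpace ℝ (Fin 3) → ℝ := fun n => cutoff ((n : ℝ) + 1) with hχ
  have hn1 : ∀ n : ℕ, (0 : ℝ) < (n : ℝ) + 1 := fun n => by positivity
  have hχT : ∀ n, IsTestFunctionOn (⊤ : Opens (EuclideanSpace ℝ (Fin 3))) (χ n) := fun n =>
    ⟨contDiff_cutoff _, hasCompactSupport_cutoff (hn1 n), by simp⟩
  have hχ1 : ∀ n x, |χ n x| ≤ 1 := fun n x => abs_cutoff_le_one _ _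
  have hDχ : ∀ n x, ‖fderiv ℝ (χ n) x‖ ≤ C / ((n : ℝ) + 1) := fun n x => hC _ (hn1 n) x
  -- `Dχₙ = 0` inside `B(0, n+1)` and outside `B̄(0, 2(n+1))`
  have hDχin : ∀ (n : ℕ) (x : EuclideanSpace ℝ (Fin 3)), ‖x‖ < (n : ℝ) + 1 → fderiv ℝ (χ n) x = 0 := by
    intro n x hx
    have hev : χ n =ᶠ[𝓝 x] fun _ => (1 : ℝ) := by
      have hopen : IsOpen {y : EuclideanSpace ℝ (Fin 3) | ‖y‖ < (n : ℝ) + 1} := isOpen_lt continuous_norm continuous_const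
      filter_upwards [hopen.mem_nhds hx] with y hy
      exact cutoff_eq_one (hn1 n) hy.le
    rw [hev.fderiv_eq, fderiv_const_apply]
  have hDχout : ∀ (n : ℕ) (x : EuclideanSpace ℝ (Fin 3)), 2 * ((n : ℝ) + 1) < ‖x‖ → fderiv ℝ (χ n) x = 0 := by
    intro n x hx
    have hev : χ n =ᶠ[𝓝 x] fun _ => (0 : ℝ) := by
      have hopen : IsOpen {y : EuclideanSpace ℝ (Fin 3) | 2 * ((n : ℝ) + 1) < ‖y‖} := isOpen_lt continuous_const continuous_norm
      filter_upwards [hopen.mem_nhds hx] with y hy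
      exact cutoff_eq_zero (hn1 n) hy.le
    rw [hev.fderiv_eq, fderiv_const_apply]
  -- the shell indicator bound `‖Dχₙ(x)‖ ‖x‖ ≤ 2C 𝟙_{‖x‖ ≥ n+1}`
  set S : ℕ → Set (EuclideanSpace ℝ (Fin 3)) := fun n => {x | (n : ℝ) + 1 ≤ ‖x‖} with hS
  have hSm : ∀ n, MeasurableSet (S n) := fun n => measurableSet_le measurable_const measurable_norm
  have hshell : ∀ (n : ℕ) (x : EuclideanSpace ℝ (Fin 3)),
      ‖fderiv ℝ (χ n) x‖ * ‖x‖ ≤ 2 * C * (S n).indicator (fun _ => (1 : ℝ)) x := by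
    intro n x
    by_cases h1 : ‖x‖ < (n : ℝ) + 1
    · rw [hDχin n x h1, norm_zero, zero_mul]
      exact mul_nonneg (by positivity) (indicator_nonneg (fun _ _ => zero_le_one) _)
    · have hxS : x ∈ S n := not_lt.1 h1
      rw [indicator_of_mem hxS, mul_one]
      by_cases h2 : 2 * ((n : ℝ) + 1) < ‖x‖
      · calc ‖fderiv ℝ (χ n) x‖ * ‖x‖ = 0 := by rw [hDχout n x h2, norm_zero, zero_mul]
          _ ≤ 2 * C := by positivity
      · calc ‖fderiv ℝ (χ n) x‖ * ‖x‖ ≤ (C / ((n : ℝ) + 1)) * (2 * ((n : ℝ) + 1)) :=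
            mul_le_mul (hDχ n x) (not_lt.1 h2) (norm_nonneg _) (div_nonneg hC0 (hn1 n).le)
          _ = 2 * C := by field_simp
  -- ### the identity at level `n`, in `fderiv` form
  have hid : ∀ n, (2 - 5 * γ) * ∫ x, χ n x * ‖V x‖ ^ 2 =
      (∫ x, (‖V x‖ ^ 2 + 2 * P x) * fderiv ℝ (χ n) x (V x)) + γ * ∫ x, ‖V x‖ ^ 2 * fderiv ℝ (χ n) x x := by
    intro n
    have h := hEE (χ n) (hχT n)
    simp only [inner_gradient_eq_fderiv_apply] at h
    exact h
  -- ### term A: `∫ χₙ |V|² → ‖V‖₂²`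
  have hA : Tendsto (fun n => ∫ x, χ n x * ‖V x‖ ^ 2) atTop (𝓝 (∫ x, ‖V x‖ ^ 2)) := by
    refine tendsto_integral_of_dominated_convergence (fun x => ‖V x‖ ^ 2) (fun n => ?_) hV2i
      (fun n => Eventually.of_forall fun x => ?_) (Eventually.of_forall fun x => ?_)
    · exact ((contDiff_cutoff (n := 0) _).continuous.aestronglyMeasurable).mul (hVm.norm.pow 2)
    · rw [norm_mul, Real.norm_eq_abs, Real.norm_of_nonneg (by positivity)]
      calc |χ n x| * ‖V x‖ ^ 2 ≤ 1 * ‖V x‖ ^ 2 := mul_le_mul_of_nonneg_right (hχ1 n x) (by positivity)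
        _ = ‖V x‖ ^ 2 := one_mul _
    · have := (tendsto_cutoff_natCast_add_one x).mul_const (‖V x‖ ^ 2)
      rwa [one_mul] at this
  -- ### term B: `|∫ (|V|²+2P) Dχₙ(V)| ≤ (C/(n+1)) ∫ (|V|³ + 2|P||V|) → 0`
  have hB : Tendsto (fun n => ∫ x, (‖V x‖ ^ 2 + 2 * P x) * fderiv ℝ (χ n) x (V x)) atTop (𝓝 0) := by
    have hbound : ∀ n, ‖∫ x, (‖V x‖ ^ 2 + 2 * P x) * fderiv ℝ (χ n) x (V x)‖ ≤
        C / ((n : ℝ) + 1) * ∫ x, (‖V x‖ ^ 3 + 2 * (|P x| * ‖V x‖)) := by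
      intro n
      rw [← integral_const_mul]
      refine norm_integral_le_of_norm_le (hFi.const_mul _) (Eventually.of_forall fun x => ?_)
      have hD : ‖fderiv ℝ (χ n) x (V x)‖ ≤ C / ((n : ℝ) + 1) * ‖V x‖ :=
        ((fderiv ℝ (χ n) x).le_opNorm _).trans (mul_le_mul_of_nonneg_right (hDχ n x) (norm_nonneg _))
      have h1 : |‖V x‖ ^ 2 + 2 * P x| ≤ ‖V x‖ ^ 2 + 2 * |P x| := by
        calc |‖V x‖ ^ 2 + 2 * P x| ≤ |‖V x‖ ^ 2| + |2 * P x| := abs_add_le _ _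
          _ = ‖V x‖ ^ 2 + 2 * |P x| := by rw [abs_of_nonneg (by positivity), abs_mul, abs_two]
      rw [norm_mul, Real.norm_eq_abs]
      calc |‖V x‖ ^ 2 + 2 * P x| * ‖fderiv ℝ (χ n) x (V x)‖
          ≤ (‖V x‖ ^ 2 + 2 * |P x|) * (C / ((n : ℝ) + 1) * ‖V x‖) :=
            mul_le_mul h1 hD (norm_nonneg _) (by positivity)
        _ = C / ((n : ℝ) + 1) * (‖V x‖ ^ 3 + 2 * (|P x| * ‖V x‖)) := by ring
    have hlim : Tendsto (fun n : ℕ => C / ((n : ℝ) + 1) * ∫ x, (‖V x‖ ^ 3 + 2 * (|P x| * ‖V x‖))) atTop (𝓝 0) := by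
      have h1 : Tendsto (fun n : ℕ => C / ((n : ℝ) + 1)) atTop (𝓝 0) := by
        have := (tendsto_one_div_add_atTop_nhds_zero_nat (𝕜 := ℝ)).const_mul C
        rw [mul_zero] at this
        refine this.congr fun n => ?_
        rw [mul_one_div]
      simpa using h1.mul_const (∫ x, (‖V x‖ ^ 3 + 2 * (|P x| * ‖V x‖)))
    exact squeeze_zero_norm hbound hlim
  -- ### term C: `|γ ∫ |V|² Dχₙ(x) x| ≤ 2C|γ| ∫_{‖x‖ ≥ n+1} |V|² → 0`
  have hC' : Tendsto (fun n => γ * ∫ x, ‖V x‖ ^ 2 * fderiv ℝ (χ n) x x) atTop (𝓝 0) := by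
    have htail : Tendsto (fun n => ∫ x, (S n).indicator (fun _ => (1 : ℝ)) x * ‖V x‖ ^ 2) atTop (𝓝 0) := by
      have h := tendsto_integral_of_dominated_convergence (μ := (volume : Measure (EuclideanSpace ℝ (Fin 3))))
        (F := fun n x => (S n).indicator (fun _ => (1 : ℝ)) x * ‖V x‖ ^ 2) (f := fun _ => (0 : ℝ))
        (fun x => ‖V x‖ ^ 2) (fun n => ?_) hV2i (fun n => Eventually.of_forall fun x => ?_)
        (Eventually.of_forall fun x => ?_)
      · simpa using h
      · exact ((aestronglyMeasurable_const.indicator (hSm n))).mul (hVm.norm.pow 2)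
      · rw [norm_mul, Real.norm_eq_abs, Real.norm_of_nonneg (by positivity)]
        have : |(S n).indicator (fun _ => (1 : ℝ)) x| ≤ 1 := by
          by_cases hx : x ∈ S n
          · rw [indicator_of_mem hx, abs_one]
          · rw [indicator_of_notMem hx, abs_zero]; exact zero_le_one
        calc |(S n).indicator (fun _ => (1 : ℝ)) x| * ‖V x‖ ^ 2 ≤ 1 * ‖V x‖ ^ 2 :=
            mul_le_mul_of_nonneg_right this (by positivity)
          _ = ‖V x‖ ^ 2 := one_mul _
      · -- eventually `x ∉ S n`
        have hev : ∀ᶠ n : ℕ in atTop, (S n).indicator (fun _ => (1 : ℝ)) x * ‖V x‖ ^ 2 = 0 := by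
          obtain ⟨N, hN⟩ := exists_nat_gt ‖x‖
          filter_upwards [eventually_ge_atTop N] with n hn
          have hx : x ∉ S n := by
            simp only [hS, mem_setOf_eq, not_le]
            calc ‖x‖ < N := hN
              _ ≤ n := by exact_mod_cast hn
              _ < (n : ℝ) + 1 := lt_add_one _
          rw [indicator_of_notMem hx, zero_mul]
        exact tendsto_const_nhds.congr' (hev.mono fun n hn => hn.symm)
    have hbound : ∀ n, ‖γ * ∫ x, ‖V x‖ ^ 2 * fderiv ℝ (χ n) x x‖ ≤
        |γ| * (2 * C) * ∫ x, (S n).indicator (fun _ => (1 : ℝ)) x * ‖V x‖ ^ 2 := by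
      intro n
      rw [norm_mul, Real.norm_eq_abs, mul_assoc]
      refine mul_le_mul_of_nonneg_left ?_ (abs_nonneg _)
      rw [← integral_const_mul]
      have hi : Integrable (fun x => (S n).indicator (fun _ => (1 : ℝ)) x * ‖V x‖ ^ 2) volume := by
        refine hV2i.mono' (((aestronglyMeasurable_const.indicator (hSm n))).mul (hVm.norm.pow 2))
          (Eventually.of_forall fun x => ?_)
        rw [norm_mul, Real.norm_eq_abs, Real.norm_of_nonneg (by positivity)]
        have : |(S n).indicator (fun _ => (1 : ℝ)) x| ≤ 1 := by
          by_cases hx : x ∈ S n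
          · rw [indicator_of_mem hx, abs_one]
          · rw [indicator_of_notMem hx, abs_zero]; exact zero_le_one
        calc |(S n).indicator (fun _ => (1 : ℝ)) x| * ‖V x‖ ^ 2 ≤ 1 * ‖V x‖ ^ 2 :=
            mul_le_mul_of_nonneg_right this (by positivity)
          _ = ‖V x‖ ^ 2 := one_mul _
      refine norm_integral_le_of_norm_le (hi.const_mul _) (Eventually.of_forall fun x => ?_)
      rw [norm_mul, Real.norm_of_nonneg (by positivity : (0 : ℝ) ≤ ‖V x‖ ^ 2), Real.norm_eq_abs]
      have hD : |fderiv ℝ (χ n) x x| ≤ 2 * C * (S n).indicator (fun _ => (1 : ℝ)) x :=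
        (Real.norm_eq_abs _ ▸ (fderiv ℝ (χ n) x).le_opNorm x).trans (hshell n x)
      calc ‖V x‖ ^ 2 * |fderiv ℝ (χ n) x x| ≤ ‖V x‖ ^ 2 * (2 * C * (S n).indicator (fun _ => (1 : ℝ)) x) :=
          mul_le_mul_of_nonneg_left hD (by positivity)
        _ = 2 * C * ((S n).indicator (fun _ => (1 : ℝ)) x * ‖V x‖ ^ 2) := by ring
    have hlim : Tendsto (fun n => |γ| * (2 * C) * ∫ x, (S n).indicator (fun _ => (1 : ℝ)) x * ‖V x‖ ^ 2)
        atTop (𝓝 0) := by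
      simpa using htail.const_mul (|γ| * (2 * C))
    exact squeeze_zero_norm hbound hlim
  -- ### conclusion
  have hlim1 : Tendsto (fun n => (2 - 5 * γ) * ∫ x, χ n x * ‖V x‖ ^ 2) atTop (𝓝 ((2 - 5 * γ) * ∫ x, ‖V x‖ ^ 2)) :=
    hA.const_mul _
  have hlim2 : Tendsto (fun n => (2 - 5 * γ) * ∫ x, χ n x * ‖V x‖ ^ 2) atTop (𝓝 0) := by
    have h := hB.add hC'
    rw [add_zero] at h
    exact h.congr fun n => (hid n).symm
  have hzero : (2 - 5 * γ) * ∫ x, ‖V x‖ ^ 2 = 0 := tendsto_nhds_unique hlim1 hlim2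
  have hγ' : (2 - 5 * γ : ℝ) ≠ 0 := by
    intro h; apply hγ; linarith
  have hint : ∫ x, ‖V x‖ ^ 2 = 0 := by
    rcases mul_eq_zero.1 hzero with h | h
    · exact absurd h hγ'
    · exact h
  have hae := (integral_eq_zero_iff_of_nonneg (fun x => by positivity) hV2i).1 hint
  filter_upwards [hae] with x hx
  have : ‖V x‖ ^ 2 = 0 := hx
  rwa [pow_eq_zero_iff two_ne_zero, norm_eq_zero] at this

end ProfileEnergy

end Summit.NavierStokesRegularity.NavierStokesRegularity.Theorems.PowerGaugeEulerLiouville
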